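import Summits.CriticalPhenomena.PercolationContinuityZ3.Theorems.Transplant.PlanarSkeletonFrmFromDefs
import Summits.CriticalPhenomena.PercolationContinuityZ3.Theorems.Transplant.SkelFrmFromBChoiceHabXW
import Summits.CriticalPhenomena.PercolationContinuityZ3.Theorems.Transplant.SkelFrmBChoiceHabXW
import Summits.CriticalPhenomena.PercolationContinuityZ3.Theorems.Transplant.SkelFrmFromBChoiceRoomV
import Summits.CriticalPhenomena.PercolationContinuityZ3.Theorems.Transplant.SkelFrmBChoiceRoomV
import Summits.CriticalPhenomena.PercolationContinuityZ3.Theorems.Transplant.SkelPhiCorridorKGPrism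
import HarnessLib
import Summits.CriticalPhenomena.PercolationContinuityZ3.Theorems.Transplant.SkelFrmBChoiceHabXVR
/-!
# U-WAVE PORT (RULING D-U, lead g21 2026-08-26; WAVE-U-MANIFEST v3.0 row «SkelFrmBChoiceHabXVR» ↦ «SkelFrmFromBChoiceHabXVR») of the tree module
# `Transplant/SkelFrmBChoiceHabXVR` onto the carrier `PlanarSkeletonFrmFrom` (frames only, cylinders connected from width `ℓ₀` on)

ORIGINAL TITLE: N2 (frames-only node `SamePDropOfSkeletonFrm₁`, OPEN) — (ζ″) at the (R-45) instance of record (76·s₀, 19·s₁ | c0 + 5·s₁ + 2, c1 + 54·s₀ + 2): THE x-CORRIDOR's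

builds on p205010 (kernel theorem, internal audit signed; external expert review pending) — nothing in this file uses p205010; NOTHING is claimed about the
OPEN node U `SamePDropOfSkeletonFrmFrom₁` (nor U_s / the end state).  Lane `prim-bschramm`, seat `prim-hp-8 gen 53 (U-wave port pen, family P-hp8; tool of record = p3-g26 port_u.py)`; helper file
(`--supports stmt-CriticalPhenomena-4575 --as helper`).  PORT RULES r1–r4 of RULING D-U: declaration order and proof texts are those of the original,
byte-identical except (i) the carrier token `PlanarSkeletonFrm ↦ PlanarSkeletonFrmFrom` (binders, `namespace`/`end` lines, qualified names of twinned
declarations), (ii) carrier-FREE declarations of the original (φ-level `Skelφ…` blocks and namespace-only arithmetic residents) are NOT re-declared —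
this file imports the original and `export`s the twin-free residents (POLICY T / treatment (m1)); residents whose statement mentions a twinned
constant are copied, (iii) every carrier-binding declaration keeps its explicit binder `(Φ : PlanarSkeletonFrmFrom G)` in its own signature (r2).  Docstrings and citations are the original's.  Manifest row idx 176 (level 19; flags verbatim|DEF-ROW); filed by the hp-8 lineage under RULING M-11 (family P-hp8).
-/

open scoped Classical

noncomputable section

namespace Summit.CriticalPhenomena.PercolationContinuityZ3.Theorems.Transplant

namespace PlanarSkeletonFrmFrom

namespace NegB

open Literature.Probability.Percolation Literature.Probability.LatticeModels SimpleGraph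
open Literature.Probability.Percolation.KozmaNitzan.Cells (oth)
open SkelConc (Consts)
open Skelφ (shearUnit kgSL kgZ₀ kgZ₁ kgM₁ kgM₂ kgWm₂ kgWp₂ kgA₁ rdLo rdHi KGRows)
open TwoAxis.Para (modulus)
open Neg

section HabXV

variable (κ : Consts) {V : Type} [DecidableEq V] [Countable V] {G : SimpleGraph V} [G.LocallyFinite] (Φ : PlanarSkeletonFrmFrom G) (t : V) (p : unitInterval)
  (D : Skelφ.StepI.DataNS V) (g f mk : ℕ)

/-- **The tight prism box's upper corner** `((N+1)n + Z₀, Top)`, `Top := A₁ + (m₁+1)R′ + m₂R′ + R′ + L` (rows top of the three phase boxes). [this work] -/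
def prismHiQ3V (κ : Consts) {V : Type} [DecidableEq V] [Countable V] {G : SimpleGraph V} [G.LocallyFinite] (Φ : PlanarSkeletonFrmFrom G) (t : V) (p : unitInterval) (D : Skelφ.StepI.DataNS V) (g : ℕ) (f : ℕ) (mk : ℕ) : Site 2 :=
  ![prismHiQ3 κ Φ t p D g f mk 0,
    (((kgA₁ (nL κ Φ t p D g f) (ℓL κ Φ t p D g f) (hL κ Φ t p D g f) (kgR κ Φ t p D mk) (kgW κ Φ t p D g f (WxQ4 κ Φ t p D g f)) (kgNv0 κ Φ t p D g f mk (qxQ4 κ Φ t p D g f) (WxQ4 κ Φ t p D g f)) : ℕ) : ℤ) + (((((kgM₁ (nL κ Φ t p D g f) (ℓL κ Φ t p D g f) (hL κ Φ t p D g f) (kgR κ Φ t p D mk) 0 (kgW κ Φ t p D g f (WxQ4 κ Φ t p D g f)) (kgNv0 κ Φ t p D g f mk (qxQ4 κ Φ t p D g f) (WxQ4 κ Φ t p D g f))) : ℕ) : ℤ)) + 1) * ((((kgR κ Φ t p D mk) : ℕ) : ℤ) + ((0 : ℕ) : ℤ)) +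
        ((((kgM₂ (nL κ Φ t p D g f) (ℓL κ Φ t p D g f) (hL κ Φ t p D g f) (vL κ Φ t p D g f) (kgR κ Φ t p D mk) 0 (kgq κ Φ t p D g f (qxQ4 κ Φ t p D g f)) (kgW κ Φ t p D g f (WxQ4 κ Φ t p D g f)) (kgNv0 κ Φ t p D g f mk (qxQ4 κ Φ t p D g f) (WxQ4 κ Φ t p D g f))) : ℕ) : ℤ)) * ((((kgR κ Φ t p D mk) : ℕ) : ℤ) + ((0 : ℕ) : ℤ)) + (((kgR κ Φ t p D mk) : ℕ) : ℤ) + ((3 * ((nL κ Φ t p D g f) * (ℓL κ Φ t p D g f)) / (shearUnit (nL κ Φ t p D g f) (hL κ Φ t p D g f)) + 1 : ℕ) : ℤ))]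

/-- `prismHiQ3V 1 = Top`, `prismHiQ3V 0 = prismHiQ3 0`. [folklore] -/
theorem prismHiQ3V_apply (κ : Consts) {V : Type} [DecidableEq V] [Countable V] {G : SimpleGraph V} [G.LocallyFinite] (Φ : PlanarSkeletonFrmFrom G) (t : V) (p : unitInterval) (D : Skelφ.StepI.DataNS V) (g : ℕ) (f : ℕ) (mk : ℕ) : prismHiQ3V κ Φ t p D g f mk 0 = prismHiQ3 κ Φ t p D g f mk 0 ∧
    prismHiQ3V κ Φ t p D g f mk 1 = (((kgA₁ (nL κ Φ t p D g f) (ℓL κ Φ t p D g f) (hL κ Φ t p D g f) (kgR κ Φ t p D mk) (kgW κ Φ t p D g f (WxQ4 κ Φ t p D g f)) (kgNv0 κ Φ t p D g f mk (qxQ4 κ Φ t p D g f) (WxQ4 κ Φ t p D g f)) : ℕ) : ℤ) + (((((kgM₁ (nL κ Φ t p D g f) (ℓL κ Φ t p D g f) (hL κ Φ t p D g f) (kgR κ Φ t p D mk) 0 (kgW κ Φ t p D g f (WxQ4 κ Φ t p D g f)) (kgNv0 κ Φ t p D g f mk (qxQ4 κ Φ t p D g f) (WxQ4 κ Φ t p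 D g f))) : ℕ) : ℤ)) + 1) * ((((kgR κ Φ t p D mk) : ℕ) : ℤ) + ((0 : ℕ) : ℤ)) +
        ((((kgM₂ (nL κ Φ t p D g f) (ℓL κ Φ t p D g f) (hL κ Φ t p D g f) (vL κ Φ t p D g f) (kgR κ Φ t p D mk) 0 (kgq κ Φ t p D g f (qxQ4 κ Φ t p D g f)) (kgW κ Φ t p D g f (WxQ4 κ Φ t p D g f)) (kgNv0 κ Φ t p D g f mk (qxQ4 κ Φ t p D g f) (WxQ4 κ Φ t p D g f))) : ℕ) : ℤ)) * ((((kgR κ Φ t p D mk) : ℕ) : ℤ) + ((0 : ℕ) : ℤ)) + (((kgR κ Φ t p D mk) : ℕ) : ℤ) + ((3 * ((nL κ Φ t p D g f) * (ℓL κ Φ t p D g f)) / (shearUnit (nL κ Φ t p D g f) (hL κ Φ t p D g f)) + 1 : ℕ) : ℤ)) := ⟨rfl, rfl⟩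

/-- **THE x-CORRIDOR's PRISM LIES IN THE TIGHT BOX** `[prismLoQ3, prismHiQ3V]` (axis 0 and the lower row from p5's Z-box, the upper row from the three
phase boxes of `mem_kgCorrSched_prism_cases`). [this work] -/
theorem prism_subset_Q3V (κ : Consts) {V : Type} [DecidableEq V] [Countable V] {G : SimpleGraph V} [G.LocallyFinite] (Φ : PlanarSkeletonFrmFrom G) (t : V) (p : unitInterval) (D : Skelφ.StepI.DataNS V) (g : ℕ) (f : ℕ) (mk : ℕ) (hN : EqNumL κ Φ t p D g f) (hg : gFloorKG κ Φ t p D mk ≤ g) :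
    (Skelφ.kgCorrSched ((kgRows0_of κ Φ t p D g f mk (qxQ4 κ Φ t p D g f) (WxQ4 κ Φ t p D g f) hN hg).kgVals_ok₁ (kgNv0 κ Φ t p D g f mk (qxQ4 κ Φ t p D g f) (WxQ4 κ Φ t p D g f))) ((kgRows0_of κ Φ t p D g f mk (qxQ4 κ Φ t p D g f) (WxQ4 κ Φ t p D g f) hN hg).kgVals_ok₂ (kgNv0 κ Φ t p D g f mk (qxQ4 κ Φ t p D g f) (WxQ4 κ Φ t p D g f))) ((kgRows0_of κ Φ t p D g f mk (qxQ4 κ Φ t p D g f) (WxQ4 κ Φ t p D g f) hN hg).kgVals_split (kgNv0 κ Φ t p D g f mk (qxQ4 κ Φ t p D g f) (WxQ4 κ Φ t p D g f)))).prism ⊆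
      Finset.Icc (prismLoQ3 κ Φ t p D g f mk) (prismHiQ3V κ Φ t p D g f mk) := by
  intro y hy
  obtain ⟨h0l, h0u, h1l, -⟩ := Skelφ.mem_kgCorrSched_prism_box ((kgRows0_of κ Φ t p D g f mk (qxQ4 κ Φ t p D g f) (WxQ4 κ Φ t p D g f) hN hg).kgVals_ok₁ (kgNv0 κ Φ t p D g f mk (qxQ4 κ Φ t p D g f) (WxQ4 κ Φ t p D g f))) ((kgRows0_of κ Φ t p D g f mk (qxQ4 κ Φ t p D g f) (WxQ4 κ Φ t p D g f) hN hg).kgVals_ok₂ (kgNv0 κ Φ t p D g f mk (qxQ4 κ Φ t p D g f) (WxQ4 κ Φ t p D g f))) ((kgRows0_of κ Φ t p D g f mk (qxQ4 κ Φ t p D g f) (WxQ4 κ Φ t p D g f) hN hg).kgVals_split (kgNv0 κ Φ t p D g f mk (qxQ4 κ Φ t p D g f) (WxQ4 κ Φ t p D g f))) hy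
  have hc := Skelφ.mem_kgCorrSched_prism_cases ((kgRows0_of κ Φ t p D g f mk (qxQ4 κ Φ t p D g f) (WxQ4 κ Φ t p D g f) hN hg).kgVals_ok₁ (kgNv0 κ Φ t p D g f mk (qxQ4 κ Φ t p D g f) (WxQ4 κ Φ t p D g f))) ((kgRows0_of κ Φ t p D g f mk (qxQ4 κ Φ t p D g f) (WxQ4 κ Φ t p D g f) hN hg).kgVals_ok₂ (kgNv0 κ Φ t p D g f mk (qxQ4 κ Φ t p D g f) (WxQ4 κ Φ t p D g f))) ((kgRows0_of κ Φ t p D g f mk (qxQ4 κ Φ t p D g f) (WxQ4 κ Φ t p D g f) hN hg).kgVals_split (kgNv0 κ Φ t p D g f mk (qxQ4 κ Φ t p D g f) (WxQ4 κ Φ t p D g f))) hy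
  have hR0 : (0 : ℤ) ≤ (((kgR κ Φ t p D mk) : ℕ) : ℤ) := Nat.cast_nonneg _
  have hm1 : (0 : ℤ) ≤ (((kgM₁ (nL κ Φ t p D g f) (ℓL κ Φ t p D g f) (hL κ Φ t p D g f) (kgR κ Φ t p D mk) 0 (kgW κ Φ t p D g f (WxQ4 κ Φ t p D g f)) (kgNv0 κ Φ t p D g f mk (qxQ4 κ Φ t p D g f) (WxQ4 κ Φ t p D g f))) : ℕ) : ℤ) := Nat.cast_nonneg _
  have hm2 : (0 : ℤ) ≤ (((kgM₂ (nL κ Φ t p D g f) (ℓL κ Φ t p D g f) (hL κ Φ t p D g f) (vL κ Φ t p D g f) (kgR κ Φ t p D mk) 0 (kgq κ Φ t p D g f (qxQ4 κ Φ t p D g f)) (kgW κ Φ t p D g f (WxQ4 κ Φ t p D g f)) (kgNv0 κ Φ t p D g f mk (qxQ4 κ Φ t p D g f) (WxQ4 κ Φ t p D g f))) : ℕ) : ℤ) := Nat.cast_nonneg _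
  have hA : ((kgA₁ (nL κ Φ t p D g f) (ℓL κ Φ t p D g f) (hL κ Φ t p D g f) (kgR κ Φ t p D mk) (kgW κ Φ t p D g f (WxQ4 κ Φ t p D g f)) (kgNv0 κ Φ t p D g f mk (qxQ4 κ Φ t p D g f) (WxQ4 κ Φ t p D g f)) : ℕ) : ℤ) = (((nL κ Φ t p D g f) * (ℓL κ Φ t p D g f) / (shearUnit (nL κ Φ t p D g f) (hL κ Φ t p D g f)) + 1 + (kgW κ Φ t p D g f (WxQ4 κ Φ t p D g f)) : ℕ) : ℤ) + ((((kgNv0 κ Φ t p D g f mk (qxQ4 κ Φ t p D g f) (WxQ4 κ Φ t p D g f)) : ℕ) : ℤ) + 1) * (((kgR κ Φ t p D mk) : ℕ) : ℤ) := by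
    unfold Skelφ.kgA₁; push_cast; ring
  rw [Finset.mem_Icc, Pi.le_def, Pi.le_def, Fin.forall_fin_two, Fin.forall_fin_two]
  refine ⟨⟨?_, ?_⟩, ?_, ?_⟩
  · show prismLoQ3 κ Φ t p D g f mk 0 ≤ y 0
    exact h0l
  · show prismLoQ3 κ Φ t p D g f mk 1 ≤ y 1
    exact h1l
  · show y 0 ≤ prismHiQ3V κ Φ t p D g f mk 0
    rw [(prismHiQ3V_apply κ Φ t p D g f mk).1]; exact h0u
  · rw [(prismHiQ3V_apply κ Φ t p D g f mk).2]
    have p1 : (0 : ℤ) ≤ (((kgM₁ (nL κ Φ t p D g f) (ℓL κ Φ t p D g f) (hL κ Φ t p D g f) (kgR κ Φ t p D mk) 0 (kgW κ Φ t p D g f (WxQ4 κ Φ t p D g f)) (kgNv0 κ Φ t p D g f mk (qxQ4 κ Φ t p D g f) (WxQ4 κ Φ t p D g f))) : ℕ) : ℤ) * ((((kgR κ Φ t p D mk) : ℕ) : ℤ) + ((0 : ℕ) : ℤ)) := mul_nonneg hm1 (by push_cast; linarith)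
    have p2 : (0 : ℤ) ≤ (((kgM₂ (nL κ Φ t p D g f) (ℓL κ Φ t p D g f) (hL κ Φ t p D g f) (vL κ Φ t p D g f) (kgR κ Φ t p D mk) 0 (kgq κ Φ t p D g f (qxQ4 κ Φ t p D g f)) (kgW κ Φ t p D g f (WxQ4 κ Φ t p D g f)) (kgNv0 κ Φ t p D g f mk (qxQ4 κ Φ t p D g f) (WxQ4 κ Φ t p D g f))) : ℕ) : ℤ) * ((((kgR κ Φ t p D mk) : ℕ) : ℤ) + ((0 : ℕ) : ℤ)) := mul_nonneg hm2 (by push_cast; linarith)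
    rcases hc with ⟨-, -, h3⟩ | ⟨-, h2, -⟩ | ⟨-, -, -, h4⟩
    · have h3' := (abs_le.1 h3).2
      rw [hA]; push_cast at h3' p1 p2 ⊢; nlinarith [h3', p1, p2, hR0]
    · rw [hA] at h2 ⊢; push_cast at h2 p1 p2 ⊢; nlinarith [h2, p2, hR0, hm1]
    · push_cast at h4 ⊢; linarith

/-- **THE x PRISM ROWS IN ROOM-FIELD FORM** (p5's `hPt` at V): `−hB 0 + 1 ≤ rdLo₁` and `rdHi₁ ≤ hF 0 − 1` for the tight box `[prismLoQ3, prismHiQ3V]` and the cells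
`fcellsV … c (hFRv … mk)` (`hB 0 = 2r₁`, `hF 0 = cRvW 0 + 5·s₁ + 2`; any creep value `c`). [this work] -/
theorem hPtV' (κ : Consts) {V : Type} [DecidableEq V] [Countable V] {G : SimpleGraph V} [G.LocallyFinite] (Φ : PlanarSkeletonFrmFrom G) (t : V) (p : unitInterval) (D : Skelφ.StepI.DataNS V) (g : ℕ) (f : ℕ) (mk : ℕ) (c : Fin 2 → ℕ) (hKq : 5 ≤ Neg.Kq κ) (hN : EqNumL κ Φ t p D g f) (hg : gFloorKG κ Φ t p D mk ≤ g) (hg2 : 40 * Neg.K κ * KS0.R'0 κ Φ t p D mk ≤ g) :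
    -(((fcellsV κ Φ t p D g f c (hFRv κ Φ t p D g f mk)).hB 0 : ℕ) : ℤ) + 1 ≤ rdLo (Aof κ) (nL κ Φ t p D g f) (hL κ Φ t p D g f) (vL κ Φ t p D g f) (vβL κ Φ t p D g f) (prFA κ Φ t p D g f).c₀ (prFA κ Φ t p D g f).c₁ (prFA κ Φ t p D g f).D (prismLoQ3 κ Φ t p D g f mk) (prismHiQ3V κ Φ t p D g f mk) 1 ∧
      rdHi (Aof κ) (nL κ Φ t p D g f) (hL κ Φ t p D g f) (vL κ Φ t p D g f) (vβL κ Φ t p D g f) (prFA κ Φ t p D g f).c₀ (prFA κ Φ t p D g f).c₁ (prFA κ Φ t p D g f).D (prismLoQ3 κ Φ t p D g f mk) (prismHiQ3V κ Φ t p D g f mk) 1 ≤ (((fcellsV κ Φ t p D g f c (hFRv κ Φ t p D g f mk)).hF 0 : ℕ) : ℤ) - 1 := by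
  constructor
  · have h := (hPt_Q3 κ Φ t p D g f mk hN hg hg2).1
    rw [Skelφ.rdLo_one] at h ⊢
    rw [fcellsV_hB, show oth (0 : Fin 2) = 1 by decide]; push_cast; exact h
  · have h := habX_box_V κ Φ t p D g f mk hKq hN hg hg2 (prismLoQ3 κ Φ t p D g f mk) (prismHiQ3V κ Φ t p D g f mk) (by rw [(prismHiQ3V_apply κ Φ t p D g f mk).2])
    rw [fcellsV_hF_eq_hFRv κ Φ t p D g f mk c hKq hN hg hg2 0, (hFRv_apply κ Φ t p D g f mk).1]; push_cast; linarith

/-- **THE x ARRIVAL BOX IN ROOM-FIELD FORM** (p5's `hLt`/`room_lastV` at V): `−hB 0 ≤ rdLo₁(arrival)` and `rdHi₁(arrival) ≤ hF 0`. [this work] -/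
theorem hLtV' (κ : Consts) {V : Type} [DecidableEq V] [Countable V] {G : SimpleGraph V} [G.LocallyFinite] (Φ : PlanarSkeletonFrmFrom G) (t : V) (p : unitInterval) (D : Skelφ.StepI.DataNS V) (g : ℕ) (f : ℕ) (mk : ℕ) (c : Fin 2 → ℕ) (hKq : 5 ≤ Neg.Kq κ) (hN : EqNumL κ Φ t p D g f) (hg : gFloorKG κ Φ t p D mk ≤ g) (hg2 : 40 * Neg.K κ * KS0.R'0 κ Φ t p D mk ≤ g) :
    -(((fcellsV κ Φ t p D g f c (hFRv κ Φ t p D g f mk)).hB 0 : ℕ) : ℤ) ≤ rdLo (Aof κ) (nL κ Φ t p D g f) (hL κ Φ t p D g f) (vL κ Φ t p D g f) (vβL κ Φ t p D g f) (prFA κ Φ t p D g f).c₀ (prFA κ Φ t p D g f).c₁ (prFA κ Φ t p D g f).D (arrLoQ3 κ Φ t p D g f mk) (arrHiQ3 κ Φ t p D g f mk) 1 ∧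
      rdHi (Aof κ) (nL κ Φ t p D g f) (hL κ Φ t p D g f) (vL κ Φ t p D g f) (vβL κ Φ t p D g f) (prFA κ Φ t p D g f).c₀ (prFA κ Φ t p D g f).c₁ (prFA κ Φ t p D g f).D (arrLoQ3 κ Φ t p D g f mk) (arrHiQ3 κ Φ t p D g f mk) 1 ≤ (((fcellsV κ Φ t p D g f c (hFRv κ Φ t p D g f mk)).hF 0 : ℕ) : ℤ) := by
  obtain ⟨hlo, -, -, hwid, hle⟩ := rd1_bounds_W κ Φ t p D g f mk hN hg hg2
  obtain ⟨hc, -⟩ := cRvW_zero_eq κ Φ t p D g f mk hN hg hg2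
  have hr1 : (((fcellsA κ Φ t p D g f).r 1 : ℕ) : ℤ) = (Neg.K κ : ℤ) * (((fcellsA κ Φ t p D g f).s 1 : ℕ) : ℤ) := by
    rw [PCells2.r_eq, show ((fcellsA κ Φ t p D g f).K : ℤ) = Neg.K κ by exact_mod_cast (fcellsA_K κ Φ t p D g f).1]
  have hK : (40 : ℤ) ≤ Neg.K κ := by exact_mod_cast (Neg.forty_le_K κ).1
  have hs1 : (1 : ℤ) ≤ (((fcellsA κ Φ t p D g f).s 1 : ℕ) : ℤ) := by exact_mod_cast (fcellsA κ Φ t p D g f).hs 1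
  have hKs : 40 * (((fcellsA κ Φ t p D g f).s 1 : ℕ) : ℤ) ≤ (Neg.K κ : ℤ) * (((fcellsA κ Φ t p D g f).s 1 : ℕ) : ℤ) := mul_le_mul_of_nonneg_right hK (by linarith)
  constructor
  · rw [fcellsV_hB, show oth (0 : Fin 2) = 1 by decide]; push_cast; rw [hr1]; linarith
  · rw [fcellsV_hF_eq_hFRv κ Φ t p D g f mk c hKq hN hg hg2 0, (hFRv_apply κ Φ t p D g f mk).1]; push_cast; rw [hc]; unfold cmidW; omega

end HabXV

end NegB

end PlanarSkeletonFrmFrom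

end Summit.CriticalPhenomena.PercolationContinuityZ3.Theorems.Transplant

end
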